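import Summits.BirchSwinnertonDyer.BirchSwinnertonDyer.Theorems.CyclotomicUntwistPSRootNumberThree
import Summits.BirchSwinnertonDyer.Rank1Residual.Additive.GordTwistMinimalModel
import Literature.NumberTheory.EllipticCurves.RootNumberTableThreeKodairaProofs
import Literature.NumberTheory.EllipticCurves.QuadraticTwistTateFormTwoProofs
import HarnessLib

/-!
# LAW L-tw3, Kodaira layer: the `χ₋₃`-TWIST INVOLUTION of the cyclic wild cell at `3` —
# `II ↔ IV*`, `IV ↔ II*` — read on Rizzo's Table II and carried to the globally minimal twist

Cell `pub/bsd-wall` (D-0145 line `route-BirchSwinnertonDyer-CyclotomicUntwist`), seat `bsd-line-cycu-p4`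
(width seat 4, gen 5). Helper toward the cruxes K1 `PSRankOneLowerHalfAtThree`
(stmt-BirchSwinnertonDyer-21580) and K2 `PSRankOneUpperHalfAtThree` (stmt-21581). THEOREMS ONLY (no
definition, no named fact, no `sorry`); route-free (no `Theses` import); BSD is not proved by this file
and no crux is.

SETTING. `V/ℚ` elliptic and globally minimal on the CYCLIC WILD CELL at `3` (`ClassO6 V 3`: additive,
`ord₃ j ≥ 0`, `f₃ ≠ 2`; and `v := v₃(Δ_min(V))` even, i.e. `v ∈ {4, 6, 10, 12}`, Kodaira `II, IV, IV*, II*`,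
Kraus inertia `C₃` or `C₆`); `d = 3` or `d = −3`; `X := V.quadraticTwist d` the tree's twisted equation
(`c₄ ↦ d²c₄`, `c₆ ↦ d³c₆`, `Δ ↦ d⁶Δ`); `W` a globally minimal model of `X` (`C • X = W`; it exists,
`Additive.exists_minimal_twist_pStar`). The route's untwisting character `η` mod `9` has order `6 = 2·3`
exactly on the `IV`/`IV*` rows, where `η = η₃ · χ₋₃` with `η₃` of order `3`: those rows are the
`χ₋₃`-twists of the `II*`/`II` rows, which is what this file proves in the kernel (Kodaira layer).

* §1 Table II, column Kod, read on rational invariants with pinned valuations (twins of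
  `PSRootNumberThreeTable.w3OfInvariants_row_*`): the four triples met by the twisted equation,
  `(4,6,10) ↦ IV*`, `(5,8,12) ↦ II*` (★ row `(1,2,0)`, shift `1`), `(6,9,16) ↦ II` (reduced `(2,3,4)`),
  `(7,11,18) ↦ IV` (reduced `(3,5,6)`).
* §2 `triple_of_cyclic`: on the cyclic wild cell `(v₃c₄, v₃c₆, v₃Δ) ∈ {(2,3,4), (3,5,6), (4,6,10), (5,8,12)}`
  (Table II's `v(N) = 4` rows, `PSRootNumberThreeTable.rows_of_condExpOfInvariants_eq_four_of_mem`, fed by the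
  discharged conductor fact and `PSKodairaDictionary.condExp_eq_four_iff_even`).
* §3 **`kodairaSymbolAt_quadraticTwist_of_cyclic`**: the Kodaira symbol at `3` of the twisted EQUATION `X`
  is `IV*, II*, II, IV` for `v = 4, 6, 10, 12` — Tate's algorithm = Table II on ANY equation
  (`kodairaSymbolAt_eq_tableKodairaSymbolThree_of_primesEquiv_eq`) evaluated by §1; and
  **`kodairaSymbolAt_twist_of_cyclic`**: the same for the globally minimal `W` (`kodairaSymbolAt_smul'`).
* §4 `addv_three_of_kodairaSymbolAt_wild` (any `E/ℚ`: a wild Kodaira symbol at `3` is additive reduction,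
  `isAdditive_kodairaSymbolAt_iff_holds` + the prime/place bridges) and **`classO6_twist_of_cyclic`**: the
  twist `W` is again on the wild cell (`ClassO6 W 3`, via `subW_three_iff_kodairaSymbolAt_wild`).
* §5 **`padicValInt_minimalDiscriminantInt_twist_of_cyclic`**: `v₃Δ_min(W) = 10, 12, 4, 6` for
  `v = 4, 6, 10, 12` (`II → IV*`, `IV → II*`, `IV* → II`, `II* → IV`): `Δ_min(W) = u⁻¹² d⁶ Δ_min(V)` gives
  `v₃Δ_min(W) ≡ v + 6 (mod 12)`, and the Papadopoulos window of the Kodaira type of `W`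
  (`PSKodairaDictionary.kodairaSymbolAt_windows`) pins the value; **`padicValRat_u_twist_of_cyclic`**:
  `ord₃ u(C) = 0` on the `II`/`IV` rows (the twisted equation is already minimal at `3`; on `IV` this is
  Kraus's gap `ord₃ c₆ ∉ {1, 2}` behind the ★ row) and `ord₃ u(C) = 1` on the `IV*`/`II*` rows (one
  rescaling). So `v ↦ v₃Δ_min(W)` is the involution `4 ↔ 10`, `6 ↔ 12` and `W` is again cyclic
  (`even_twist_of_cyclic`).

The unit-part / principal-series layer (`Δ′ mod 9`, PS ↔ PS, `W₃ ↦ −W₃`, Kraus order `3 ↔ 6`, `c₃`, conductor,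
symmetry) is the sequel `CyclotomicUntwistPSTwistInvolution.lean`.

References: O. G. Rizzo, Compositio Math. 136 (2003), §1.1–1.2, Table II [Rizzo2003]; I. Papadopoulos, J. Number
Theory 44 (1993), Table III [Papadopoulos1993]; A. Kraus, Manuscripta Math. 69 (1990) [Kraus1990], Acta Arith. 54
(1989) Prop. 1 [Kraus1989]; J. H. Silverman, *AEC* VII.1, X.2 [SilvermanAEC2009], *ATAEC* IV.9.4 [SilvermanATAEC1994].
-/

open scoped Classical

open WeierstrassCurve IsDedekindDomain Rat.HeightOneSpectrum Literature.NumberTheory.EllipticCurves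
  Literature.NumberTheory.EllipticCurves.Rank1Residual Literature.NumberTheory.DiophantineGeometry
  Summit.BirchSwinnertonDyer.Rank1Residual.Additive

set_option linter.dupNamespace false -- single-conjunct summit: the name repeats by design
set_option autoImplicit false

namespace Summit.BirchSwinnertonDyer.BirchSwinnertonDyer.Theorems.PSTwistInvolution

/-! ### §1 Table II, column Kod, on rational invariants: the four triples met by the twisted equation -/

section Table

/-- Table II, column Kod, on rational invariants with reduced valuation triple `(a, b, c)` (shift `0`).
[cite: Rizzo2003, §1.1–1.2 (pp. 3–4) and Table II (p. 4), column Kod] -/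
theorem kodairaOfInvariants_eq_of_shift_zero {q₄ q₆ qΔ : ℚ} {a b c : ℤ} (hq₄ : q₄ ≠ 0) (hq₆ : q₆ ≠ 0)
    (h4 : padicValRat 3 q₄ = a) (h6 : padicValRat 3 q₆ = b) (hΔ : padicValRat 3 qΔ = c)
    (hs : KellockDokchitser.shift c (b : WithTop ℤ) (a : WithTop ℤ) = 0) :
    Rizzo.kodairaOfInvariants q₄ q₆ qΔ =
      (Rizzo.tableII (a : WithTop ℤ) (b : WithTop ℤ) c (Rizzo.res9 q₄) (Rizzo.res9 q₆) (Rizzo.res9 qΔ)).1 := by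
  unfold Rizzo.kodairaOfInvariants Rizzo.ofInvariants
  dsimp only
  rw [PSRootNumberThreeTable.val3_eq_coe hq₄, PSRootNumberThreeTable.val3_eq_coe hq₆, h4, h6, hΔ, hs]
  simp only [WithTop.map_coe, mul_zero, sub_zero]

/-- Table II, column Kod, on rational invariants whose valuation triple `(a, b, c)` has shift `1` (reduced
triple `(a − 4, b − 6, c − 12)`). [cite: Rizzo2003, §1.1–1.2 (pp. 3–4) and Table II (p. 4), column Kod] -/
theorem kodairaOfInvariants_eq_of_shift_one {q₄ q₆ qΔ : ℚ} {a b c : ℤ} (hq₄ : q₄ ≠ 0) (hq₆ : q₆ ≠ 0)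
    (h4 : padicValRat 3 q₄ = a) (h6 : padicValRat 3 q₆ = b) (hΔ : padicValRat 3 qΔ = c)
    (hs : KellockDokchitser.shift c (b : WithTop ℤ) (a : WithTop ℤ) = 1) :
    Rizzo.kodairaOfInvariants q₄ q₆ qΔ =
      (Rizzo.tableII ((a - 4 : ℤ) : WithTop ℤ) ((b - 6 : ℤ) : WithTop ℤ) (c - 12)
        (Rizzo.res9 q₄) (Rizzo.res9 q₆) (Rizzo.res9 qΔ)).1 := by
  unfold Rizzo.kodairaOfInvariants Rizzo.ofInvariants
  dsimp only
  rw [PSRootNumberThreeTable.val3_eq_coe hq₄, PSRootNumberThreeTable.val3_eq_coe hq₆, h4, h6, hΔ, hs]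
  simp only [WithTop.map_coe, mul_one]

/-- Triple `(4,6,10)` (the twist of a `II` row; reduced, shift `0`): Kodaira `IV*`.
[cite: Rizzo2003, Table II (p. 4), row (4,6,10)] -/
theorem kodairaOfInvariants_row_4_6_10 {q₄ q₆ qΔ : ℚ} (hq₄ : q₄ ≠ 0) (hq₆ : q₆ ≠ 0)
    (h4 : padicValRat 3 q₄ = 4) (h6 : padicValRat 3 q₆ = 6) (hΔ : padicValRat 3 qΔ = 10) :
    Rizzo.kodairaOfInvariants q₄ q₆ qΔ = .IVstar := by
  rw [kodairaOfInvariants_eq_of_shift_zero (a := 4) (b := 6) (c := 10) hq₄ hq₆ h4 h6 hΔ (by decide)]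
  exact Rizzo.kodaira_row_4_6_10 _ _ _

/-- Triple `(5,8,12)` (the twist of a `IV` row; the ★ row `(1,2,0)` after the shift `1`): Kodaira `II*`.
[cite: Rizzo2003, Table II (p. 4), row (1,2,0)] -/
theorem kodairaOfInvariants_row_5_8_12 {q₄ q₆ qΔ : ℚ} (hq₄ : q₄ ≠ 0) (hq₆ : q₆ ≠ 0)
    (h4 : padicValRat 3 q₄ = 5) (h6 : padicValRat 3 q₆ = 8) (hΔ : padicValRat 3 qΔ = 12) :
    Rizzo.kodairaOfInvariants q₄ q₆ qΔ = .IIstar := by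
  rw [kodairaOfInvariants_eq_of_shift_one (a := 5) (b := 8) (c := 12) hq₄ hq₆ h4 h6 hΔ (by decide)]
  exact Rizzo.kodaira_row_1_2_0 _ _ _

/-- Triple `(6,9,16)` (the twist of a `IV*` row; reduced triple `(2,3,4)` after the shift `1`): Kodaira `II`.
[cite: Rizzo2003, Table II (p. 4), row (2,3,4)] -/
theorem kodairaOfInvariants_row_6_9_16 {q₄ q₆ qΔ : ℚ} (hq₄ : q₄ ≠ 0) (hq₆ : q₆ ≠ 0)
    (h4 : padicValRat 3 q₄ = 6) (h6 : padicValRat 3 q₆ = 9) (hΔ : padicValRat 3 qΔ = 16) :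
    Rizzo.kodairaOfInvariants q₄ q₆ qΔ = .II := by
  rw [kodairaOfInvariants_eq_of_shift_one (a := 6) (b := 9) (c := 16) hq₄ hq₆ h4 h6 hΔ (by decide)]
  exact Rizzo.kodaira_row_2_3_4 _ _ _

/-- Triple `(7,11,18)` (the twist of a `II*` row; reduced triple `(3,5,6)` after the shift `1`): Kodaira `IV`.
[cite: Rizzo2003, Table II (p. 4), row (3,5,6)] -/
theorem kodairaOfInvariants_row_7_11_18 {q₄ q₆ qΔ : ℚ} (hq₄ : q₄ ≠ 0) (hq₆ : q₆ ≠ 0)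
    (h4 : padicValRat 3 q₄ = 7) (h6 : padicValRat 3 q₆ = 11) (hΔ : padicValRat 3 qΔ = 18) :
    Rizzo.kodairaOfInvariants q₄ q₆ qΔ = .IV := by
  rw [kodairaOfInvariants_eq_of_shift_one (a := 7) (b := 11) (c := 18) hq₄ hq₆ h4 h6 hΔ (by decide)]
  exact Rizzo.kodaira_row_3_5_6 _ _ _

end Table

/-! ### §2 The valuation triples `(v₃c₄, v₃c₆, v₃Δ)` on the cyclic wild cell -/

section Cyclic

variable (V : WeierstrassCurve ℚ) [V.IsElliptic] [V.IsGloballyMinimal]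

omit [V.IsElliptic] in
/-- `v₃(Δ(V)) = v₃(Δ_min)` for a globally minimal `V` (its discriminant IS the minimal discriminant).
[cite: SilvermanAEC2009, VIII.8 (minimal discriminant)] -/
theorem padicValRat_Δ_eq : padicValRat 3 V.Δ = padicValInt 3 V.minimalDiscriminantInt := by
  rw [← cast_minimalDiscriminantInt V, padicValRat.of_int]

/-- **The Kraus signatures of the cyclic wild cell.** On `ClassO6 V 3` with `v₃(Δ_min)` even:
`(v₃c₄, v₃c₆, v₃Δ_min) ∈ {(2,3,4), (3,5,6), (4,6,10), (5,8,12)}` (rows `II, IV, IV*, II*` of Table II with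
`v(N) = 4`), read on the rational invariants of `V`. [cite: Papadopoulos1993, Table III (p = 3)]
[cite: Rizzo2003, Table II (p. 4)] [cite: Kraus1990, Théorème (p = 3)] -/
theorem triple_of_cyclic (hO6 : ClassO6 V 3) (hev : Even (padicValInt 3 V.minimalDiscriminantInt)) :
    V.c₄ ≠ 0 ∧ V.c₆ ≠ 0 ∧
      ((padicValRat 3 V.c₄ = 2 ∧ padicValRat 3 V.c₆ = 3 ∧ padicValInt 3 V.minimalDiscriminantInt = 4) ∨
        (padicValRat 3 V.c₄ = 3 ∧ padicValRat 3 V.c₆ = 5 ∧ padicValInt 3 V.minimalDiscriminantInt = 6) ∨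
        (padicValRat 3 V.c₄ = 4 ∧ padicValRat 3 V.c₆ = 6 ∧ padicValInt 3 V.minimalDiscriminantInt = 10) ∨
        (padicValRat 3 V.c₄ = 5 ∧ padicValRat 3 V.c₆ = 8 ∧
          padicValInt 3 V.minimalDiscriminantInt = 12)) := by
  obtain ⟨-, hadd, hW⟩ := hO6
  have hf : condExp V 3 = 4 := (PSKodairaDictionary.condExp_eq_four_iff_even V hadd hW).mpr hev
  have h := PSRootNumberThree.condExpOfInvariants_eq_four_of_condExp V hf
  have hvΔ := padicValRat_Δ_eq V
  have hmem := PSKodairaDictionary.padicValInt_mem_of_even V hadd hW hev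
  have hv : padicValRat 3 V.Δ = 4 ∨ padicValRat 3 V.Δ = 6 ∨ padicValRat 3 V.Δ = 10 ∨
      padicValRat 3 V.Δ = 12 := by
    rw [hvΔ]; exact_mod_cast hmem
  obtain ⟨hc4, hc6, hrows⟩ := PSRootNumberThreeTable.rows_of_condExpOfInvariants_eq_four_of_mem h hv
  refine ⟨hc4, hc6, ?_⟩
  rw [hvΔ] at hrows
  rcases hrows with ⟨h1, h2, h3⟩ | ⟨h1, h2, h3⟩ | ⟨h1, h2, h3⟩ | ⟨h1, h2, h3⟩
  · exact Or.inl ⟨h1, h2, by exact_mod_cast h3⟩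
  · exact Or.inr (Or.inl ⟨h1, h2, by exact_mod_cast h3⟩)
  · exact Or.inr (Or.inr (Or.inl ⟨h1, h2, by exact_mod_cast h3⟩))
  · exact Or.inr (Or.inr (Or.inr ⟨h1, h2, by exact_mod_cast h3⟩))

end Cyclic

/-! ### §3 The Kodaira symbol at `3` of the twisted equation and of its globally minimal model -/

section Twist

variable (V : WeierstrassCurve ℚ) [V.IsElliptic] [V.IsGloballyMinimal]

/-- `v₃(±3) = 1`. [folklore] -/
theorem padicValRat_pm_three {d : ℤ} (hd : d = 3 ∨ d = -3) : padicValRat 3 (d : ℚ) = 1 := by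
  rcases hd with rfl | rfl
  · push_cast; exact_mod_cast padicValRat.self (p := 3) (by norm_num)
  · push_cast; rw [padicValRat.neg]; exact_mod_cast padicValRat.self (p := 3) (by norm_num)

/-- `±3 ≠ 0` in `ℚ`. [folklore] -/
theorem cast_ne_zero_of_pm_three {d : ℤ} (hd : d = 3 ∨ d = -3) : (d : ℚ) ≠ 0 := by
  rcases hd with rfl | rfl <;> norm_num
/-- The place `placeOf 3` of `ℤ` lies over the prime `3`. [folklore] -/
theorem primesEquiv_placeOf_three : ((primesEquiv (placeOf 3) : Nat.Primes) : ℕ) = 3 :=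
  congrArg Subtype.val ((primesEquiv (R := ℤ)).apply_symm_apply ⟨3, Nat.prime_three⟩)

/-- The valuations of the invariants of the twisted equation `X = V^{(d)}`, `d = ±3`:
`(v₃c₄, v₃c₆, v₃Δ)(X) = (v₃c₄, v₃c₆, v₃Δ)(V) + (2, 3, 6)` (`c₄ ↦ d²c₄`, `c₆ ↦ d³c₆`, `Δ ↦ d⁶Δ`).
[cite: SilvermanAEC2009, X.2 Prop. 2.4 and III.1 Table 3.1] -/
theorem padicValRat_quadraticTwist {d : ℤ} (hd : d = 3 ∨ d = -3) (hc4 : V.c₄ ≠ 0) (hc6 : V.c₆ ≠ 0) :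
    (V.quadraticTwist (d : ℚ)).c₄ ≠ 0 ∧ (V.quadraticTwist (d : ℚ)).c₆ ≠ 0 ∧
    padicValRat 3 (V.quadraticTwist (d : ℚ)).c₄ = padicValRat 3 V.c₄ + 2 ∧
    padicValRat 3 (V.quadraticTwist (d : ℚ)).c₆ = padicValRat 3 V.c₆ + 3 ∧
    padicValRat 3 (V.quadraticTwist (d : ℚ)).Δ = padicValInt 3 V.minimalDiscriminantInt + 6 := by
  have hd0 := cast_ne_zero_of_pm_three hd
  have hd1 := padicValRat_pm_three hd
  have hΔ0 : V.Δ ≠ 0 := V.isUnit_Δ.ne_zero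
  rw [quadraticTwist_c₄, quadraticTwist_c₆, quadraticTwist_Δ]
  refine ⟨mul_ne_zero (pow_ne_zero _ hd0) hc4, mul_ne_zero (pow_ne_zero _ hd0) hc6, ?_, ?_, ?_⟩
  · rw [padicValRat.mul (pow_ne_zero _ hd0) hc4, padicValRat.pow, hd1]; ring
  · rw [padicValRat.mul (pow_ne_zero _ hd0) hc6, padicValRat.pow, hd1]; ring
  · rw [padicValRat.mul (pow_ne_zero _ hd0) hΔ0, padicValRat.pow, hd1, padicValRat_Δ_eq V]; ring

/-- **The Kodaira symbol at `3` of the twisted EQUATION `X = V^{(±3)}` on the cyclic wild cell:**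
`IV*` if `v₃Δ_min(V) = 4` (`V` of type `II`), `II*` if `6` (`IV`), `II` if `10` (`IV*`), `IV` if `12` (`II*`).
Tate's algorithm on `X ⊗ ℚ₃` is Table II read on the invariants of the equation `X`
(`kodairaSymbolAt_eq_tableKodairaSymbolThree_of_primesEquiv_eq`, any equation of the curve), whose
valuation triple is `(v₃c₄, v₃c₆, v₃Δ)(V) + (2,3,6)` (§2, `padicValRat_quadraticTwist`), evaluated by §1.
[cite: Rizzo2003, Table II (p. 4)] [cite: Papadopoulos1993, Table III (p = 3)]
[cite: SilvermanAEC2009, X.2 Prop. 2.4] -/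
theorem kodairaSymbolAt_quadraticTwist_of_cyclic (hO6 : ClassO6 V 3)
    (hev : Even (padicValInt 3 V.minimalDiscriminantInt)) {d : ℤ} (hd : d = 3 ∨ d = -3) :
    ((V.quadraticTwist (d : ℚ)).kodairaSymbolAt (placeOf 3) = .IVstar ∧
        padicValInt 3 V.minimalDiscriminantInt = 4) ∨
      ((V.quadraticTwist (d : ℚ)).kodairaSymbolAt (placeOf 3) = .IIstar ∧
        padicValInt 3 V.minimalDiscriminantInt = 6) ∨
      ((V.quadraticTwist (d : ℚ)).kodairaSymbolAt (placeOf 3) = .II ∧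
        padicValInt 3 V.minimalDiscriminantInt = 10) ∨
      ((V.quadraticTwist (d : ℚ)).kodairaSymbolAt (placeOf 3) = .IV ∧
        padicValInt 3 V.minimalDiscriminantInt = 12) := by
  have hd0 := cast_ne_zero_of_pm_three hd
  haveI : (V.quadraticTwist (d : ℚ)).IsElliptic := V.isElliptic_quadraticTwist hd0
  obtain ⟨hc4, hc6, hrows⟩ := triple_of_cyclic V hO6 hev
  obtain ⟨hX4, hX6, hv4, hv6, hvΔ⟩ := padicValRat_quadraticTwist V hd hc4 hc6
  rw [kodairaSymbolAt_eq_tableKodairaSymbolThree_of_primesEquiv_eq (placeOf 3) _ primesEquiv_placeOf_three,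
    tableKodairaSymbolThree_def]
  rcases hrows with ⟨h1, h2, h3⟩ | ⟨h1, h2, h3⟩ | ⟨h1, h2, h3⟩ | ⟨h1, h2, h3⟩ <;>
    rw [h1] at hv4 <;> rw [h2] at hv6 <;> rw [h3] at hvΔ ⊢ <;> norm_num1 at hv4 hv6 hvΔ
  · exact Or.inl ⟨kodairaOfInvariants_row_4_6_10 hX4 hX6 hv4 hv6 hvΔ, rfl⟩
  · exact Or.inr (Or.inl ⟨kodairaOfInvariants_row_5_8_12 hX4 hX6 hv4 hv6 hvΔ, rfl⟩)
  · exact Or.inr (Or.inr (Or.inl ⟨kodairaOfInvariants_row_6_9_16 hX4 hX6 hv4 hv6 hvΔ, rfl⟩))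
  · exact Or.inr (Or.inr (Or.inr ⟨kodairaOfInvariants_row_7_11_18 hX4 hX6 hv4 hv6 hvΔ, rfl⟩))

variable (W : WeierstrassCurve ℚ)

/-- **The Kodaira symbol at `3` of the TWIST, on its globally minimal (or any) model `W`** (`C • V^{(±3)} = W`):
`II → IV*`, `IV → II*`, `IV* → II`, `II* → IV` (by `v₃Δ_min(V) = 4, 6, 10, 12`). The Kodaira symbol is an
isomorphism invariant (`kodairaSymbolAt_smul'`, Tate 1975). [cite: SilvermanATAEC1994, IV.9.4 and Table 4.1]
[cite: Rizzo2003, Table II (p. 4)] -/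
theorem kodairaSymbolAt_twist_of_cyclic (hO6 : ClassO6 V 3)
    (hev : Even (padicValInt 3 V.minimalDiscriminantInt)) {d : ℤ} (hd : d = 3 ∨ d = -3)
    (C : VariableChange ℚ) (hC : C • V.quadraticTwist (d : ℚ) = W) :
    (W.kodairaSymbolAt (placeOf 3) = .IVstar ∧ padicValInt 3 V.minimalDiscriminantInt = 4) ∨
      (W.kodairaSymbolAt (placeOf 3) = .IIstar ∧ padicValInt 3 V.minimalDiscriminantInt = 6) ∨
      (W.kodairaSymbolAt (placeOf 3) = .II ∧ padicValInt 3 V.minimalDiscriminantInt = 10) ∨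
      (W.kodairaSymbolAt (placeOf 3) = .IV ∧ padicValInt 3 V.minimalDiscriminantInt = 12) := by
  have hd0 := cast_ne_zero_of_pm_three hd
  haveI : (V.quadraticTwist (d : ℚ)).IsElliptic := V.isElliptic_quadraticTwist hd0
  haveI : PerfectField (IsLocalRing.ResidueField ((placeOf 3).adicCompletionIntegers ℚ)) :=
    PerfectField.ofFinite
  have hK : W.kodairaSymbolAt (placeOf 3) = (V.quadraticTwist (d : ℚ)).kodairaSymbolAt (placeOf 3) := by
    rw [← hC, kodairaSymbolAt_smul']
  rw [hK]
  exact kodairaSymbolAt_quadraticTwist_of_cyclic V hO6 hev hd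

end Twist

/-! ### §4 The twist is again on the wild cell at `3` -/

section WildCell

variable (W : WeierstrassCurve ℚ) [W.IsElliptic]

/-- **A wild Kodaira symbol at `3` (`II, IV, IV*, II*`) is ADDITIVE reduction** in the cell's currency
`Addv W 3` — for any equation of any `E/ℚ`: the symbol is of additive type, so `W` has additive reduction at
the place of `3` (`isAdditive_kodairaSymbolAt_iff_holds`), which excludes good and multiplicative reduction
(prime/place bridges `hasGood/MultiplicativeReductionAtPrime_iff_…At_holds`).
[cite: SilvermanAEC2009, VII.5 Prop. 5.1] [cite: SilvermanATAEC1994, IV.9.4] -/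
theorem addv_three_of_kodairaSymbolAt_wild
    (hK : W.kodairaSymbolAt (placeOf 3) = .II ∨ W.kodairaSymbolAt (placeOf 3) = .IV ∨
      W.kodairaSymbolAt (placeOf 3) = .IVstar ∨ W.kodairaSymbolAt (placeOf 3) = .IIstar) :
    Addv W 3 := by
  haveI : PerfectField (IsLocalRing.ResidueField ((placeOf 3).adicCompletionIntegers ℚ)) :=
    PerfectField.ofFinite
  have hKA : (W.kodairaSymbolAt (placeOf 3)).IsAdditive := by
    rcases hK with h | h | h | h <;> rw [h] <;>
      exact ⟨fun h0 ↦ KodairaSymbol.noConfusion h0, fun ⟨_, _, hn⟩ ↦ KodairaSymbol.noConfusion hn⟩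
  have hA : W.HasAdditiveReductionAt (placeOf 3) :=
    (isAdditive_kodairaSymbolAt_iff_holds (placeOf 3) W).mp hKA
  refine ⟨fun hg ↦ ?_, fun hm ↦ ?_⟩
  · exact hA.not_hasGoodReductionAt
      ((W.hasGoodReductionAtPrime_iff_hasGoodReductionAt_holds ⟨3, Nat.prime_three⟩).mp hg)
  · exact hA.not_hasMultiplicativeReductionAt
      ((W.hasMultiplicativeReductionAtPrime_iff_hasMultiplicativeReductionAt_holds
        ⟨3, Nat.prime_three⟩).mp hm)

/-- A wild Kodaira symbol at `3` puts `E` on the WILD CELL `ClassO6 W 3` (additive, `ord₃ j ≥ 0`, `f₃ ≠ 2`;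
the dictionary `subW_three_iff_kodairaSymbolAt_wild`). [cite: SilvermanATAEC1994, IV.9.4, Table 4.1 and IV.10.4]
[cite: Kraus1990, Théorème (p = 3)] -/
theorem classO6_three_of_kodairaSymbolAt_wild
    (hK : W.kodairaSymbolAt (placeOf 3) = .II ∨ W.kodairaSymbolAt (placeOf 3) = .IV ∨
      W.kodairaSymbolAt (placeOf 3) = .IVstar ∨ W.kodairaSymbolAt (placeOf 3) = .IIstar) :
    ClassO6 W 3 := by
  have hadd := addv_three_of_kodairaSymbolAt_wild W hK
  exact ⟨by norm_num, hadd, (subW_three_iff_kodairaSymbolAt_wild W hadd).mpr hK⟩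

variable (V : WeierstrassCurve ℚ) [V.IsElliptic] [V.IsGloballyMinimal]

/-- **The `±3`-twist of a curve on the cyclic wild cell at `3` is again on the wild cell** (`ClassO6 W 3` for
any model `W` of `V^{(±3)}`). [cite: SilvermanATAEC1994, IV.9.4 and Table 4.1] [cite: Rizzo2003, Table II (p. 4)] -/
theorem classO6_twist_of_cyclic (hO6 : ClassO6 V 3) (hev : Even (padicValInt 3 V.minimalDiscriminantInt))
    {d : ℤ} (hd : d = 3 ∨ d = -3) (C : VariableChange ℚ) (hC : C • V.quadraticTwist (d : ℚ) = W) :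
    ClassO6 W 3 := by
  refine classO6_three_of_kodairaSymbolAt_wild W ?_
  rcases kodairaSymbolAt_twist_of_cyclic V W hO6 hev hd C hC with ⟨h, -⟩ | ⟨h, -⟩ | ⟨h, -⟩ | ⟨h, -⟩
  · exact Or.inr (Or.inr (Or.inl h))
  · exact Or.inr (Or.inr (Or.inr h))
  · exact Or.inl h
  · exact Or.inr (Or.inl h)

end WildCell

/-! ### §5 `v₃Δ_min` of the twist: the involution `4 ↔ 10`, `6 ↔ 12`, and `ord₃ u ∈ {0, 1}` -/

section Discriminant

variable (V W : WeierstrassCurve ℚ) [V.IsElliptic] [V.IsGloballyMinimal] [W.IsElliptic] [W.IsGloballyMinimal]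

omit [W.IsElliptic] in
/-- `v₃Δ_min(W) = v₃Δ_min(V) + 6 − 12·ord₃ u(C)` for `C • V^{(±3)} = W` (`Δ(C • X) = u⁻¹² Δ(X)`,
`Δ(V^{(d)}) = d⁶ Δ(V)`); verbatim the computation of `Additive.padicValInt_minimalDiscriminantInt_twist_pm_p_of_lt_six`
without its minimality input. [cite: SilvermanAEC2009, III.1 Table 3.1 and X.2 Prop. 2.4] -/
theorem padicValInt_minimalDiscriminantInt_twist_eq {d : ℤ} (hd : d = 3 ∨ d = -3)
    (C : VariableChange ℚ) (hC : C • V.quadraticTwist (d : ℚ) = W) :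
    (padicValInt 3 W.minimalDiscriminantInt : ℤ) =
      padicValInt 3 V.minimalDiscriminantInt + 6 - 12 * padicValRat 3 (C.u : ℚ) := by
  have hu0 : (C.u : ℚ) ≠ 0 := C.u.ne_zero
  have hd0 := cast_ne_zero_of_pm_three hd
  have hdv := padicValRat_pm_three hd
  have hVΔ : (V.minimalDiscriminantInt : ℚ) ≠ 0 := by exact_mod_cast V.minimalDiscriminantInt_ne_zero
  have hΔ : (W.minimalDiscriminantInt : ℚ) =
      (C.u : ℚ)⁻¹ ^ 12 * ((d : ℚ) ^ 6 * V.minimalDiscriminantInt) := by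
    rw [cast_minimalDiscriminantInt, cast_minimalDiscriminantInt, ← hC, variableChange_Δ,
      quadraticTwist_Δ, Units.val_inv_eq_inv_val]
  have key : (padicValInt 3 W.minimalDiscriminantInt : ℤ) =
      padicValRat 3 ((C.u : ℚ)⁻¹ ^ 12 * ((d : ℚ) ^ 6 * V.minimalDiscriminantInt)) := by
    rw [← padicValRat.of_int, hΔ]
  rw [padicValRat.mul (pow_ne_zero _ (inv_ne_zero hu0)) (mul_ne_zero (pow_ne_zero _ hd0) hVΔ),
    padicValRat.mul (pow_ne_zero _ hd0) hVΔ, padicValRat.pow, padicValRat.pow, padicValRat.inv,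
    hdv, padicValRat.of_int] at key
  rw [key]; push_cast; ring

/-- **`v₃Δ_min` of the `±3`-twist on the cyclic wild cell: `4 ↦ 10`, `6 ↦ 12`, `10 ↦ 4`, `12 ↦ 6`**
(`II → IV*`, `IV → II*`, `IV* → II`, `II* → IV`), for `C • V^{(±3)} = W` with `V`, `W` globally minimal. The
congruence `v₃Δ_min(W) ≡ v₃Δ_min(V) + 6 (mod 12)` (`padicValInt_minimalDiscriminantInt_twist_eq`) meets the
Papadopoulos window of the Kodaira type of `W` (§3; `PSKodairaDictionary.kodairaSymbolAt_windows`: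
`IV* ∈ [9,11]`, `II* ∈ [11,13]`, `II ∈ [3,5]`, `IV ∈ [5,7]`) in exactly one value.
[cite: Papadopoulos1993, Table III (p = 3)] [cite: SilvermanATAEC1994, IV.9.4, Table 4.1 and IV.10.4]
[cite: SilvermanAEC2009, X.2 Prop. 2.4] -/
theorem padicValInt_minimalDiscriminantInt_twist_of_cyclic (hO6 : ClassO6 V 3)
    (hev : Even (padicValInt 3 V.minimalDiscriminantInt)) {d : ℤ} (hd : d = 3 ∨ d = -3)
    (C : VariableChange ℚ) (hC : C • V.quadraticTwist (d : ℚ) = W) :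
    (padicValInt 3 V.minimalDiscriminantInt = 4 ∧ padicValInt 3 W.minimalDiscriminantInt = 10 ∧
        padicValRat 3 (C.u : ℚ) = 0) ∨
      (padicValInt 3 V.minimalDiscriminantInt = 6 ∧ padicValInt 3 W.minimalDiscriminantInt = 12 ∧
        padicValRat 3 (C.u : ℚ) = 0) ∨
      (padicValInt 3 V.minimalDiscriminantInt = 10 ∧ padicValInt 3 W.minimalDiscriminantInt = 4 ∧
        padicValRat 3 (C.u : ℚ) = 1) ∨
      (padicValInt 3 V.minimalDiscriminantInt = 12 ∧ padicValInt 3 W.minimalDiscriminantInt = 6 ∧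
        padicValRat 3 (C.u : ℚ) = 1) := by
  have key := padicValInt_minimalDiscriminantInt_twist_eq V W hd C hC
  obtain ⟨-, haddW, hWW⟩ := classO6_twist_of_cyclic W V hO6 hev hd C hC
  have hwin := PSKodairaDictionary.kodairaSymbolAt_windows W haddW hWW
  rcases kodairaSymbolAt_twist_of_cyclic V W hO6 hev hd C hC with ⟨hK, hv⟩ | ⟨hK, hv⟩ | ⟨hK, hv⟩ | ⟨hK, hv⟩ <;>
    rw [hv] at key ⊢ <;>
    rcases hwin with ⟨hK', h1, h2, -⟩ | ⟨hK', h1, h2, -⟩ | ⟨hK', h1, h2, -⟩ | ⟨hK', h1, h2, -⟩ <;>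
    rw [hK] at hK' <;> first | exact absurd hK' (by decide) | skip
  · left; refine ⟨rfl, ?_, ?_⟩ <;> omega
  · right; left; refine ⟨rfl, ?_, ?_⟩ <;> omega
  · right; right; left; refine ⟨rfl, ?_, ?_⟩ <;> omega
  · right; right; right; refine ⟨rfl, ?_, ?_⟩ <;> omega

/-- **`ord₃ u(C) = 0` on the `II`/`IV` rows and `= 1` on the `IV*`/`II*` rows**: the twisted equation
`V^{(±3)}` is already minimal at `3` when `v₃Δ_min(V) ≤ 6` (on the `IV` row this is Kraus's gap
`ord₃ c₆ ∉ {1, 2}`, the ★ row of Table II), and one rescaling `(x, y) ↦ (9x, 27y)` away from minimal otherwise.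
[cite: Kraus1989, Prop. 1] [cite: Rizzo2003, Table II (p. 4), row (1,2,0)] [cite: SilvermanAEC2009, VII.1 Prop. 1.3] -/
theorem padicValRat_u_twist_of_cyclic (hO6 : ClassO6 V 3)
    (hev : Even (padicValInt 3 V.minimalDiscriminantInt)) {d : ℤ} (hd : d = 3 ∨ d = -3)
    (C : VariableChange ℚ) (hC : C • V.quadraticTwist (d : ℚ) = W) :
    padicValRat 3 (C.u : ℚ) = if padicValInt 3 V.minimalDiscriminantInt ≤ 6 then 0 else 1 := by
  rcases padicValInt_minimalDiscriminantInt_twist_of_cyclic V W hO6 hev hd C hC with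
    ⟨hv, -, hu⟩ | ⟨hv, -, hu⟩ | ⟨hv, -, hu⟩ | ⟨hv, -, hu⟩ <;> rw [hv, hu] <;> decide

/-- **The twist stays CYCLIC**: `v₃Δ_min(W)` is even again (so `W` is on the cyclic wild cell
`ClassO6 W 3 ∧ v₃Δ_min(W)` even, inertia `C₃`/`C₆`, `f₃ = 4`). [cite: Kraus1990, Théorème (p = 3)]
[cite: Papadopoulos1993, Table III (p = 3)] -/
theorem even_twist_of_cyclic (hO6 : ClassO6 V 3) (hev : Even (padicValInt 3 V.minimalDiscriminantInt))
    {d : ℤ} (hd : d = 3 ∨ d = -3) (C : VariableChange ℚ) (hC : C • V.quadraticTwist (d : ℚ) = W) :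
    Even (padicValInt 3 W.minimalDiscriminantInt) := by
  rcases padicValInt_minimalDiscriminantInt_twist_of_cyclic V W hO6 hev hd C hC with
    ⟨-, hw, -⟩ | ⟨-, hw, -⟩ | ⟨-, hw, -⟩ | ⟨-, hw, -⟩ <;> rw [hw] <;> decide

end Discriminant

end Summit.BirchSwinnertonDyer.BirchSwinnertonDyer.Theorems.PSTwistInvolution
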